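import Mathlib.RingTheory.Radical.NatInt
import Mathlib.NumberTheory.Padics.HeightOneSpectrum
import Mathlib.NumberTheory.Padics.RingHoms
import Mathlib.RingTheory.LocalRing.ResidueField.Basic
import Mathlib.FieldTheory.Perfect
import Literature.NumberTheory.DiophantineGeometry.TateAlgorithm
import HarnessLib

-- provenance: harness21/H21/H21/Prelude/DiophValNum/Conductor.lean @ 7998fb0 (interim HEAD d8f2665); M5 mechanical rewrite
/-!
# The conductor of a Weierstrass curve

Trunk: `DiophValNum` (item C5 `Conductor`).

Let `A` be a Dedekind domain with fraction field `K`, `v : HeightOneSpectrum A` a finite place and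
`W : WeierstrassCurve K`. The *conductor exponent* `f_v` of `W` at `v` is defined here through
**Ogg's formula** (Ogg 1967, Saito 1988; Silverman ATAEC IV.11.1)

`f_v = ord_v (Δ_min) + 1 − m_v`,

where `ord_v (Δ_min) = W.ordMinimalDiscriminant v` (`Literature.Prelude.DiophValNum.MinimalDiscriminant`)
and `m_v = W.numComponentsAt v` is the number of geometric irreducible components of the special
fibre of the minimal proper regular model, computed by Tate's algorithm
(`Literature.Prelude.DiophValNum.TateAlgorithm`). By the Ogg–Saito theorem this agrees with the
representation-theoretic definition `f_v = ε_v + δ_v` (tame part `ε_v = codim` of the inertia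
invariants of `V_ℓ E`, wild part `δ_v` the Swan conductor), Silverman ATAEC IV.10.

## Main definitions

* `WeierstrassCurve.conductorExponent v W : ℕ` — `f_v` (Ogg's formula);
* `WeierstrassCurve.wildConductorExponent v W : ℕ` — the wild part `δ_v = f_v − ε_v`;
* `WeierstrassCurve.conductor A W : Ideal A` — the conductor ideal `𝔣 (E/K) = ∏_v 𝔭_v ^ f_v`;
* `WeierstrassCurve.conductorNorm A W : ℕ` — its absolute norm; for `A = ℤ` this is the conductor
  `N_E` of `E / ℚ`.

## Ownership and naming

* This file is **the** definition of the conductor `N_E` / `𝔣 (E/K)` of an elliptic curve in H21 (it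
  also realises the `bsd`/`lang` inventory notion `conductor` filed under T-GALREP). The Galois
  representation files (items G09/G16) must **not** define a second conductor of an elliptic curve;
  their Artin/Swan conductor of an `ℓ`-adic (Weil–Deligne) representation lives in a
  `GaloisRep`/`WeilDeligne` namespace, and the comparison
  `WeierstrassCurve.conductorExponent_eq_artinConductor` (Ogg–Saito in its representation-theoretic
  form) is *their* glue theorem, not stated here.
* Mathlib has a root-level `conductor` (`Mathlib/RingTheory/Conductor.lean`, the conductor of an
  order `conductor R x : Ideal (Algebra.adjoin R {x})`), unrelated. Inside
  `namespace WeierstrassCurve` our `WeierstrassCurve.conductor` wins; outside the namespace always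
  write `W.conductor A` or the fully qualified name `WeierstrassCurve.conductor`.
* Mathlib has no conductor of an elliptic curve (searched `conductor`, `Conductor` in
  `AlgebraicGeometry/EllipticCurve/`); we use Mathlib's `Ideal.absNorm`, `finprod`,
  `Rat.HeightOneSpectrum.natGenerator`, `UniqueFactorizationMonoid.radical`, `Nat.factorization`.

## Design notes

* All declarations live in `namespace WeierstrassCurve` (deliberate dot-notation extension of a
  Mathlib namespace, as in `LocalReduction`, `MinimalDiscriminant`, `TateAlgorithm`). `A` is
  implicit in declarations taking `v`, explicit in the global ones (`W.conductor A`,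
  `W.conductorNorm A`).
* **`ℕ`-subtraction.** `conductorExponent` is `ord_v (Δ_min) + 1 - m_v` in `ℕ`. For an elliptic `W`
  over a perfect residue field this subtraction never truncates, by
  `WeierstrassCurve.numComponentsAt_le` (Ogg–Saito: `m_v ≤ ord_v (Δ_min) + 1`). Likewise `wildConductorExponent = f_v - ε_v` never truncates since
  `ε_v ≤ f_v` (Silverman ATAEC IV.10.2). For a singular `W` (`Δ = 0`) all values are junk
  (`ordMinimalDiscriminant` is then the junk value `0`).
* **`finprod`.** As for `minimalDiscriminantIdeal`, the multiplicative support of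
  `v ↦ 𝔭_v ^ f_v` is contained in the finite set of bad places for elliptic `W`
  (`conductorExponent_le_ordMinimalDiscriminant`, `finite_setOf_ordMinimalDiscriminant_ne_zero`), so
  the product is a genuine finite product; for singular `W` it is the junk value `1 = ⊤`.
* `Ideal.absNorm` only needs `[Module.Free ℤ A]`; `[Module.Finite ℤ A]` would be added only on
  lemmas needing it (none here: the norm lemmas are stated over `A = ℤ`).
* **Perfectness hypotheses.** Following `Literature.Prelude.DiophValNum.TateAlgorithm`, every lemma resting
  on Tate's algorithm returning the *correct* Kodaira symbol (Silverman ATAEC IV.10.2(a)–(c),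
  invariance under `VariableChange`, semistability criterion) carries the instance hypothesis
  `[PerfectField (IsLocalRing.ResidueField (v.adicCompletionIntegers K))]` (resp. its `∀ v` form for
  global statements), the standing hypothesis of Tate 1975 and ATAEC §IV.9. The invariance lemmas
  `conductorExponent_smul`, `conductor_smul` moreover need `[W.IsElliptic]`, like the upstream
  `WeierstrassCurve.kodairaSymbol_smul` (for singular `W` the junk Kodaira symbols of
  `K`-isomorphic models may differ). The tameness lemma
  `conductorExponent_eq_tameConductorExponent` (residue characteristic `≠ 2, 3`) does not need it,
  for the reason recorded at `WeierstrassCurve.ordMinimalDiscriminant_eq_numComponentsAt_add_one`.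
* **Bridge over `ℚ`.** Mathlib has no `Finite`/`PerfectField` instance for the residue field of
  `v.adicCompletionIntegers K`. For `K = ℚ` we supply the (new, non-overriding, `Prop`-valued)
  instance `Literature.NumberTheory.DiophantineGeometry.Rat.finite_residueField_adicCompletionIntegers` from Mathlib's
  `Rat.HeightOneSpectrum.adicCompletionIntegers.padicIntEquiv : O_v ≃ ℤ_[p]` and
  `PadicInt.residueField : 𝓀 (ℤ_[p]) ≃+* ZMod p`; `PerfectField` then follows from Mathlib's
  `PerfectField.ofFinite`, so the lemmas over `ℚ` below carry no perfectness hypothesis.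

## References

* A. P. Ogg, *Elliptic curves and wild ramification*, Amer. J. Math. 89 (1967), 1–21.
* T. Saito, *Conductor, discriminant, and the Noether formula of arithmetic surfaces*, Duke Math. J.
  57 (1988), 151–173.
* J. H. Silverman, *Advanced Topics in the Arithmetic of Elliptic Curves* (ATAEC), GTM 151, 1994,
  §IV.10 (conductor, Thm 10.2, Thm 10.4), §IV.11 (Ogg's formula 11.1).
* A. Brumer, K. Kramer, *The conductor of an abelian variety*, Compositio Math. 92 (1994), 227–248.
* P. Lockhart, M. Rosen, J. H. Silverman, *An upper bound for the conductor of an abelian variety*,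
  J. Algebraic Geom. 2 (1993), 569–601.
-/

open IsDedekindDomain

namespace Literature.NumberTheory.DiophantineGeometry.Rat

/-- Over `ℚ` the residue field of the completed local ring `O_v = v.adicCompletionIntegers ℚ` at a
finite place `v` of a ring of integers `R` of `ℚ` (e.g. `R = ℤ`) is finite: `O_v ≃ ℤ_[p]`
(Mathlib `Rat.HeightOneSpectrum.adicCompletionIntegers.padicIntEquiv`) and `ℤ_[p] / (p) ≃ 𝔽_p`
(Mathlib `PadicInt.residueField`). Consequently `PerfectField (IsLocalRing.ResidueField O_v)` holds
by Mathlib's `PerfectField.ofFinite`, discharging the perfectness hypotheses of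
`Literature.Prelude.DiophValNum.TateAlgorithm` and of this file over `ℚ`. New `Prop`-valued instance, not
overriding any Mathlib instance. Serre, *Local Fields*, II §4. [folklore] -/
instance finite_residueField_adicCompletionIntegers {R : Type*} [CommRing R] [IsDedekindDomain R]
    [Algebra R ℚ] [IsFractionRing R ℚ] [IsIntegralClosure R ℤ ℚ] (v : HeightOneSpectrum R) :
    Finite (IsLocalRing.ResidueField (v.adicCompletionIntegers ℚ)) :=
  -- Theorem-style name kept (a `Prop`-valued instance; the name is cited by downstream H21 files).
  haveI : Fact (Nat.Prime (Rat.HeightOneSpectrum.primesEquiv v : ℕ)) :=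
    ⟨(Rat.HeightOneSpectrum.primesEquiv v).2⟩
  Finite.of_equiv (ZMod (Rat.HeightOneSpectrum.primesEquiv v))
    ((IsLocalRing.ResidueField.mapEquiv
        (Rat.HeightOneSpectrum.adicCompletionIntegers.padicIntEquiv v).toRingEquiv).trans
      (PadicInt.residueField (p := Rat.HeightOneSpectrum.primesEquiv v))).symm.toEquiv

end Literature.NumberTheory.DiophantineGeometry.Rat

namespace WeierstrassCurve


section Local

variable {A : Type*} [CommRing A] [IsDedekindDomain A] {K : Type*} [Field K]
  [Algebra A K] [IsFractionRing A K] (v : HeightOneSpectrum A) (W : WeierstrassCurve K)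

/-- `W.conductorExponent v = f_v`: the exponent of the conductor of `W / K` at the finite place `v`,
defined by **Ogg's formula** `f_v = ord_v (Δ_min) + 1 − m_v`, where `m_v = W.numComponentsAt v` is
the number of geometric irreducible components of the special fibre of the minimal proper regular
model at `v` (Tate's algorithm). The `ℕ`-subtraction never truncates for an elliptic `W` over a
perfect residue field, by `WeierstrassCurve.numComponentsAt_le`; for a singular `W` (`Δ = 0`) the value is junk.
By Ogg–Saito this equals `ε_v + δ_v` (tame + wild/Swan part) of the `ℓ`-adic representation.
Ogg 1967; Saito 1988; Silverman ATAEC IV.10 (definition) and IV.11.1 (Ogg's formula).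
(Dot-notation extension of the Mathlib namespace `WeierstrassCurve`.) [cite: Ogg1967] -/
noncomputable def conductorExponent : ℕ :=
  W.ordMinimalDiscriminant v + 1 - W.numComponentsAt v

/-- `W.wildConductorExponent v = δ_v`: the wild part (Swan conductor) of the conductor exponent at
`v`, `δ_v = f_v − ε_v` where `ε_v = (W.kodairaSymbolAt v).tameConductorExponent ∈ {0, 1, 2}` is the
tame part (`0`, `1`, `2` for good, multiplicative, additive reduction). The `ℕ`-subtraction never
truncates for an elliptic `W` (`ε_v ≤ f_v`, Silverman ATAEC IV.10.2); `δ_v = 0` unless the residue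
characteristic is `2` or `3` (`conductorExponent_eq_tameConductorExponent`).
Silverman ATAEC IV.10 (definition of `δ`), Thm IV.10.2. [folklore] -/
noncomputable def wildConductorExponent : ℕ :=
  W.conductorExponent v - (W.kodairaSymbolAt v).tameConductorExponent

end Local

section Global

variable (A : Type*) [CommRing A] [IsDedekindDomain A] {K : Type*} [Field K]
  [Algebra A K] [IsFractionRing A K] (W : WeierstrassCurve K)

/-- `W.conductor A = 𝔣 (E/K)`: the conductor ideal of `W / K`, the ideal `∏_v 𝔭_v ^ f_v` of `A`,
where `v` runs over the finite places (height-one primes) of `A` and `f_v = W.conductorExponent v`.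
For an elliptic `W` the multiplicative support is contained in the finite set of bad places, so
`finprod` is a genuine finite product; for a singular `W` (`Δ = 0`) it is the junk value `1 = ⊤`
(same conventions as `WeierstrassCurve.minimalDiscriminantIdeal`).
Outside `namespace WeierstrassCurve` write `W.conductor A` / `WeierstrassCurve.conductor` (Mathlib
has an unrelated root-level `conductor`). Silverman ATAEC IV.10 (definition following Thm 10.2);
AEC VIII.11 / C.16. (Dot-notation extension of the Mathlib namespace `WeierstrassCurve`.) [folklore] -/
noncomputable def conductor : Ideal A :=
  ∏ᶠ v : HeightOneSpectrum A, v.asIdeal ^ W.conductorExponent v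

/-- `W.conductorNorm A = N (𝔣 (E/K))`: the absolute norm (`Ideal.absNorm`) of the conductor ideal.
For `A = ℤ`, `K = ℚ` this is the conductor `N_E = ∏_p p ^ f_p` of `E / ℚ`
(`factorization_conductorNorm`); for `A = 𝓞 K` it is `N_{K/ℚ} 𝔣 (E/K)`. Junk value `1` for
singular `W`. Silverman ATAEC IV.10; AEC C.16.
(Dot-notation extension of the Mathlib namespace `WeierstrassCurve`.) [folklore] -/
noncomputable def conductorNorm [Module.Free ℤ A] : ℕ :=
  Ideal.absNorm (W.conductor A)

end Global

/-! ### API -/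

section LocalAPI

variable {A : Type*} [CommRing A] [IsDedekindDomain A] {K : Type*} [Field K]
  [Algebra A K] [IsFractionRing A K] (v : HeightOneSpectrum A) (W : WeierstrassCurve K)

/-- `f_v ≤ ord_v (Δ_min)`, since every Kodaira type has at least one component (`m_v ≥ 1`).
Silverman ATAEC IV.11.1 and Table 4.1. [folklore] -/
theorem conductorExponent_le_ordMinimalDiscriminant :
    W.conductorExponent v ≤ W.ordMinimalDiscriminant v := by
  have := (W.kodairaSymbolAt v).numComponents_pos
  unfold conductorExponent numComponentsAt
  omega

/-- If the residue characteristic of `v` is neither `2` nor `3`, the conductor is tame: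
`f_v = ε_v ∈ {0, 1, 2}` (i.e. `δ_v = 0`). No perfectness hypothesis on the residue field is
needed (in residue characteristic `≥ 5` Tate's algorithm is correct over any residue field, cf.
`WeierstrassCurve.ordMinimalDiscriminant_eq_numComponentsAt_add_one`).
Silverman ATAEC IV.10.2(c) and IV.10.4. [cite: Silverman1994, IV.10.4] -/
def conductorExponent_eq_tameConductorExponent : Prop :=
  ∀ [W.IsElliptic] (h2 : ringChar (A ⧸ v.asIdeal) ≠ 2) (h3 : ringChar (A ⧸ v.asIdeal) ≠ 3),
    W.conductorExponent v = (W.kodairaSymbolAt v).tameConductorExponent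

/-- If the residue characteristic of `v` is neither `2` nor `3`, the wild part of the conductor
vanishes: `δ_v = 0` (from the named fact `conductorExponent_eq_tameConductorExponent`,
hypothesis `h`). Silverman ATAEC IV.10.2(c). [folklore] -/
theorem wildConductorExponent_eq_zero (h : conductorExponent_eq_tameConductorExponent v W)
    [W.IsElliptic] (h2 : ringChar (A ⧸ v.asIdeal) ≠ 2) (h3 : ringChar (A ⧸ v.asIdeal) ≠ 3) :
    W.wildConductorExponent v = 0 := by
  rw [wildConductorExponent, h h2 h3, Nat.sub_self]

/- The named facts below quantify the standing hypothesis of Tate's algorithm, perfectness of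
the residue field at `v`, explicitly (a `Prop`-valued `def` does not pick up unused instance
variables); the theorems consuming them take it as a section instance. -/
variable [PerfectField (IsLocalRing.ResidueField (v.adicCompletionIntegers K))]

/-- `f_v = 0` iff `W` has good reduction at `v` (perfect residue field, the standing hypothesis of
Tate's algorithm). Silverman ATAEC IV.10.2(a); AEC VII.5.1(a). [cite: Silverman1994, IV.10.2(a)] -/
def conductorExponent_eq_zero_iff : Prop :=
  ∀ [PerfectField (IsLocalRing.ResidueField (v.adicCompletionIntegers K))] [W.IsElliptic],
    W.conductorExponent v = 0 ↔ W.HasGoodReductionAt v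

/-- `f_v = 1` iff `W` has multiplicative reduction at `v` (perfect residue field).
Silverman ATAEC IV.10.2(b). [cite: Silverman1994, IV.10.2(b)] -/
def conductorExponent_eq_one_iff : Prop :=
  ∀ [PerfectField (IsLocalRing.ResidueField (v.adicCompletionIntegers K))] [W.IsElliptic],
    W.conductorExponent v = 1 ↔ W.HasMultiplicativeReductionAt v

/-- `f_v ≥ 2` iff `W` has additive reduction at `v` (`f_v = 2 + δ_v`, `δ_v ≥ 0`; perfect residue
field). Silverman ATAEC IV.10.2(c). [cite: Silverman1994, IV.10.2(c)] -/
def two_le_conductorExponent_iff : Prop :=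
  ∀ [PerfectField (IsLocalRing.ResidueField (v.adicCompletionIntegers K))] [W.IsElliptic],
    2 ≤ W.conductorExponent v ↔ W.HasAdditiveReductionAt v

/-- `f_v = ε_v + δ_v`: the conductor exponent is the sum of its tame part
`ε_v = (W.kodairaSymbolAt v).tameConductorExponent` and its wild part `δ_v`; equivalently
`ε_v ≤ f_v`, so that the `ℕ`-subtraction defining `wildConductorExponent` does not truncate
(perfect residue field). Silverman ATAEC IV.10, Thm 10.2. [cite: Silverman1994, IV.10 Thm. 10.2] -/
def conductorExponent_eq_tameConductorExponent_add_wildConductorExponent : Prop :=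
  ∀ [PerfectField (IsLocalRing.ResidueField (v.adicCompletionIntegers K))] [W.IsElliptic],
    W.conductorExponent v =
      (W.kodairaSymbolAt v).tameConductorExponent + W.wildConductorExponent v

/-- `f_v ≠ 0` iff `ord_v (Δ_min) ≠ 0` (both say that `v` is a bad place): the conductor and the
minimal discriminant have the same support (perfect residue field; from the named facts
`conductorExponent_eq_zero_iff` and `ordMinimalDiscriminant_eq_zero_iff`, hypotheses `h0`, `hΔ`).
Silverman ATAEC IV.10.2(a), AEC VII.5.1(a). [folklore] -/
theorem conductorExponent_ne_zero_iff (h0 : conductorExponent_eq_zero_iff v W)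
    (hΔ : ordMinimalDiscriminant_eq_zero_iff v W) [W.IsElliptic] :
    W.conductorExponent v ≠ 0 ↔ W.ordMinimalDiscriminant v ≠ 0 := by
  rw [Ne, h0, ← hΔ]

/-- The conductor exponent is an isomorphism invariant of `W / K`: it is unchanged under an
admissible change of variables `C • W` (elliptic `W` and perfect residue field, as for
`WeierstrassCurve.kodairaSymbol_smul`; for singular `W` the junk values need not agree).
Silverman ATAEC IV.10 (the conductor is an isogeny, a fortiori isomorphism, invariant); follows
from the named facts `ordMinimalDiscriminant_smul` and `kodairaSymbol_smul` (hypotheses `hΔ`,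
`hK`, the latter for the completed local ring at `v`). [folklore] -/
theorem conductorExponent_smul (hΔ : ordMinimalDiscriminant_smul v W)
    (hK : kodairaSymbol_smul (R := v.adicCompletionIntegers K) (K := v.adicCompletion K))
    [W.IsElliptic] (C : VariableChange K) :
    (C • W).conductorExponent v = W.conductorExponent v := by
  unfold kodairaSymbol_smul at hK
  simp only [conductorExponent, hΔ C, numComponentsAt, kodairaSymbolAt, baseChange,
    ← map_variableChange, hK]

end LocalAPI

section GlobalAPI

variable (A : Type*) [CommRing A] [IsDedekindDomain A] {K : Type*} [Field K]
  [Algebra A K] [IsFractionRing A K] (W : WeierstrassCurve K)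

/-- `𝔣 (E/K) ∣ 𝔇_min`, i.e. `𝔇_min ≤ 𝔣` as ideals: `f_v ≤ ord_v (Δ_min)` at every place
(`conductorExponent_le_ordMinimalDiscriminant`), both products being finite products over the bad
places (`finite_setOf_ordMinimalDiscriminant_ne_zero`, whence `[W.IsElliptic]`).
The finiteness is the named fact `finite_setOf_ordMinimalDiscriminant_ne_zero` (hypothesis
`hfinite`). Silverman ATAEC IV.11.1; AEC VIII.11. [folklore] -/
theorem minimalDiscriminantIdeal_le_conductor
    (hfinite : W.finite_setOf_ordMinimalDiscriminant_ne_zero (A := A)) [W.IsElliptic] :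
    W.minimalDiscriminantIdeal A ≤ W.conductor A := by
  classical
  have hfin := hfinite
  have hsubD : (Function.mulSupport fun v : HeightOneSpectrum A =>
      v.asIdeal ^ W.ordMinimalDiscriminant v) ⊆ hfin.toFinset := by
    intro v hv
    simp only [Set.Finite.coe_toFinset, Set.mem_setOf_eq, Function.mem_mulSupport] at hv ⊢
    intro h
    exact hv (by rw [h, pow_zero])
  have hsubF : (Function.mulSupport fun v : HeightOneSpectrum A =>
      v.asIdeal ^ W.conductorExponent v) ⊆ hfin.toFinset := by
    intro v hv
    simp only [Set.Finite.coe_toFinset, Set.mem_setOf_eq, Function.mem_mulSupport] at hv ⊢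
    intro h
    have hf : W.conductorExponent v = 0 :=
      Nat.eq_zero_of_le_zero (h ▸ conductorExponent_le_ordMinimalDiscriminant v W)
    exact hv (by rw [hf, pow_zero])
  rw [minimalDiscriminantIdeal, conductor, finprod_eq_prod_of_mulSupport_subset _ hsubD,
    finprod_eq_prod_of_mulSupport_subset _ hsubF]
  exact Ideal.le_of_dvd (Finset.prod_dvd_prod_of_dvd _ _ fun v _ =>
    pow_dvd_pow _ (conductorExponent_le_ordMinimalDiscriminant v W))

/-- The conductor ideal is nonzero: a (finite, or junk-empty) product of powers of nonzero primes of
the domain `A`. No `[W.IsElliptic]` hypothesis is needed (same convention as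
`WeierstrassCurve.minimalDiscriminantIdeal_ne_bot`). Silverman ATAEC IV.10. [folklore] -/
theorem conductor_ne_bot : W.conductor A ≠ ⊥ := by
  refine finprod_induction (fun I : Ideal A => I ≠ ⊥) ?_ ?_ ?_
  · rw [Ideal.one_eq_top]
    exact top_ne_bot
  · intro I J hI hJ
    rw [← Ideal.zero_eq_bot] at hI hJ ⊢
    exact mul_ne_zero hI hJ
  · intro v
    rw [← Ideal.zero_eq_bot]
    exact pow_ne_zero _ (Ideal.zero_eq_bot (R := A) ▸ v.ne_bot)

variable
  [∀ v : HeightOneSpectrum A, PerfectField (IsLocalRing.ResidueField (v.adicCompletionIntegers K))]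

/-- The conductor ideal is an isomorphism invariant of an elliptic `W / K` (perfect residue
fields; from `conductorExponent_smul` at every place, i.e. from the upstream named facts
`ordMinimalDiscriminant_smul` and `kodairaSymbol_smul`, hypotheses `hΔ`, `hK`).
Silverman ATAEC IV.10. [folklore] -/
theorem conductor_smul (hΔ : ∀ v : HeightOneSpectrum A, ordMinimalDiscriminant_smul v W)
    (hK : ∀ v : HeightOneSpectrum A,
      kodairaSymbol_smul (R := v.adicCompletionIntegers K) (K := v.adicCompletion K))
    [W.IsElliptic] (C : VariableChange K) : (C • W).conductor A = W.conductor A := by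
  simp only [conductor, fun v ↦ conductorExponent_smul v W (hΔ v) (hK v) C]

/-- `W` is semistable iff `f_v ≤ 1` at every finite place, i.e. iff the conductor is squarefree
(perfect residue fields; from the named facts `conductorExponent_eq_zero_iff` and
`conductorExponent_eq_one_iff` at every place, hypotheses `h0`, `h1`). Silverman ATAEC IV.10.2. [folklore] -/
theorem isSemistable_iff_conductorExponent_le_one
    (h0 : ∀ v : HeightOneSpectrum A, conductorExponent_eq_zero_iff v W)
    (h1 : ∀ v : HeightOneSpectrum A, conductorExponent_eq_one_iff v W) [W.IsElliptic] :
    W.IsSemistable A ↔ ∀ v : HeightOneSpectrum A, W.conductorExponent v ≤ 1 := by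
  refine forall_congr' fun v => ?_
  rw [IsSemistableAt, ← h0 v, ← h1 v]
  omega

end GlobalAPI

section Rat

/-! Over `A = ℤ`, `K = ℚ` the perfectness hypotheses are discharged by the instance
`Literature.NumberTheory.DiophantineGeometry.Rat.finite_residueField_adicCompletionIntegers` and Mathlib's `PerfectField.ofFinite`.
The named facts below quantify `[W.IsElliptic]` explicitly (a `Prop`-valued `def` drops the
unused section instance), matching the printed statements for elliptic curves. -/

variable (W : WeierstrassCurve ℚ) [W.IsElliptic] (v : HeightOneSpectrum ℤ)

-- Sanity check: over `ℚ` the invariance lemma applies with no perfectness hypothesis (only the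
-- upstream named facts `ordMinimalDiscriminant_smul`, `kodairaSymbol_smul`).
example (hΔ : ∀ v : HeightOneSpectrum ℤ, ordMinimalDiscriminant_smul v W)
    (hK : ∀ v : HeightOneSpectrum ℤ,
      kodairaSymbol_smul (R := v.adicCompletionIntegers ℚ) (K := v.adicCompletion ℚ))
    (C : VariableChange ℚ) : (C • W).conductor ℤ = W.conductor ℤ :=
  conductor_smul ℤ W hΔ hK C

/-- Over `ℚ`: `f_p ≤ 8` for every prime `p` (the maximum `8` is attained only at `p = 2`).
Brumer–Kramer 1994, Thm 6.2; Lockhart–Rosen–Silverman 1993; Silverman ATAEC IV.10.4 and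
Ex. 4.51. [cite: BrumerKramer1994, Thm 6.2] -/
def conductorExponent_le_eight : Prop :=
  ∀ [W.IsElliptic], W.conductorExponent v ≤ 8

/-- Over `ℚ`: `f_3 ≤ 5`. Brumer–Kramer 1994, Thm 6.2; Lockhart–Rosen–Silverman 1993;
Silverman ATAEC IV.10.4. [cite: BrumerKramer1994, Thm 6.2] -/
def conductorExponent_le_five_of_natGenerator_eq_three : Prop :=
  ∀ [W.IsElliptic], Rat.HeightOneSpectrum.natGenerator v = 3 → W.conductorExponent v ≤ 5

/-- Over `ℚ`: `f_p ≤ 2` for `p ≥ 5` (the conductor is tame away from `2` and `3`).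
Silverman ATAEC IV.10.2(c), IV.10.4. [cite: Silverman1994, IV.10.4] -/
def conductorExponent_le_two_of_five_le_natGenerator : Prop :=
  ∀ [W.IsElliptic], 5 ≤ Rat.HeightOneSpectrum.natGenerator v → W.conductorExponent v ≤ 2

/-- Over `ℤ ⊆ ℚ`: the conductor `N_E` of an elliptic `W / ℚ` is positive. Silverman ATAEC IV.10;
AEC C.16. [cite: SilvermanAEC2009, C.16] -/
def conductorNorm_pos : Prop :=
  ∀ [W.IsElliptic], 0 < W.conductorNorm ℤ

/-- Over `ℤ ⊆ ℚ`: the exponent of the prime `p` below `v` in `N_E` is `f_p`, i.e.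
`N_E = ∏_p p ^ f_p` (`Rat.HeightOneSpectrum.natGenerator v` is the prime generating `v.asIdeal`).
Silverman ATAEC IV.10; AEC C.16. [cite: SilvermanAEC2009, C.16] -/
def factorization_conductorNorm : Prop :=
  ∀ [W.IsElliptic],
    (W.conductorNorm ℤ).factorization (Rat.HeightOneSpectrum.natGenerator v) =
      W.conductorExponent v

/-- Over `ℤ ⊆ ℚ`: `N_E` and `|Δ_min|` have the same prime divisors (the bad primes), i.e. equal
radicals in `ℕ`. Silverman ATAEC IV.10.2(a); AEC VII.5.1(a), VIII.11. [cite: SilvermanAEC2009, VII.5.1(a)] -/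
def radical_conductorNorm_eq : Prop :=
  ∀ [W.IsElliptic],
    UniqueFactorizationMonoid.radical (W.conductorNorm ℤ) =
      UniqueFactorizationMonoid.radical (W.minimalDiscriminantNorm ℤ)

/-- Over `ℤ ⊆ ℚ`: `N_E ∣ |Δ_min|` (`f_p ≤ ord_p (Δ_min)` for every `p`).
Hypothesis: the named fact `finite_setOf_ordMinimalDiscriminant_ne_zero` (via
`minimalDiscriminantIdeal_le_conductor`). Silverman ATAEC IV.11.1; AEC VIII.11. [folklore] -/
theorem conductorNorm_dvd_minimalDiscriminantNorm
    (hfinite : W.finite_setOf_ordMinimalDiscriminant_ne_zero (A := ℤ)) :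
    W.conductorNorm ℤ ∣ W.minimalDiscriminantNorm ℤ :=
  Ideal.absNorm_dvd_absNorm_of_le (W.minimalDiscriminantIdeal_le_conductor ℤ hfinite)

omit [W.IsElliptic] in
/-- Discharge of the named fact `WeierstrassCurve.conductorNorm_pos`: the conductor
`N_E = #(ℤ / 𝔣(E/ℚ))` of an elliptic curve over `ℚ` is a positive integer (Silverman ATAEC IV.10;
AEC C.16). Proof: the ideal `W.conductor ℤ = ∏ᶠ_v 𝔭_v ^ f_v` is a `finprod` of non-zero prime
powers of `ℤ` (or its junk value `1` if the support were infinite), hence non-zero, so its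
absolute norm is non-zero (`Ideal.absNorm_eq_zero_iff`); ellipticity is not even needed.
[cite: SilvermanAEC2009, C.16] -/
theorem conductorNorm_pos_holds : W.conductorNorm_pos := by
  intro _
  unfold conductorNorm conductor
  rw [Nat.pos_iff_ne_zero, Ne, Ideal.absNorm_eq_zero_iff]
  refine finprod_induction (fun I : Ideal ℤ ↦ I ≠ ⊥) ?_ ?_ ?_
  · exact (Ideal.one_eq_top (R := ℤ)) ▸ top_ne_bot
  · intro I J hI hJ
    exact mul_ne_zero hI hJ
  · intro v
    exact pow_ne_zero _ v.ne_bot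

end Rat

end WeierstrassCurve
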